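import Mathlib.Tactic.DeriveFintype
import Literature.Computability.Complexity.NondeterministicProofs
import Literature.Computability.Complexity.TimeBoundsProofs
import HarnessLib

/-!
# Applying a polynomial-time map to the first component of a pair: `⟨x, y⟩ ↦ ⟨f x, y⟩ ∈ FP`

Machine-level infrastructure for the certificate calculus of `NP = polyExists P`
(`Nondeterministic.lean`; Arora–Barak 2009, Def. 2.1). Closure of `NP` under Karp reductions
(Arora–Barak 2009, Thm. 2.8 / Exercise 2.9: "if `L ≤ₚ L'` and `L' ∈ NP` then `L ∈ NP`") is,
at the level of certificates, the statement that from a reduction `f ∈ FP` one gets the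
polynomial-time map `⟨x, y⟩ ↦ ⟨f x, y⟩` on pair-coded strings — run the machine of `f` on the
first component while the certificate `y` is parked on a work stack. This file proves exactly
that: for `f ∈ FP`,

  `mapFstFn f ∈ FP`,  `mapFstFn f (boolPair x y) = boolPair (f x) y`

(`mapFstFn_mem_FP`, `mapFstFn_boolPair`); on malformed input `z` the value is
`boolPair (f (boolUnpair z).1) (readRest z)` (whatever is left after the pair reader stops).

## The machine (`MapFstTM.machine tm e₀ e₁`)

Given a bundled `tm : Turing.FinTM2` computing `f` (input/output alphabets identified with `Bool`
by `e₀`, `e₁`), the wrapped machine has stacks `tm.K ⊕ Aux` (two extra `Bool` stacks `S`, `Y`),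
labels `tm.Λ ⊕ Label`, states `tm.σ × Option Bool × Option Bool` (two registers), input stack
`inl k₀`, output stack `inl k₁`, and control (cf. `PairFstTM.machine`, which drops `y` instead of
keeping it):

* `read`: pop the input two symbols at a time; an equal pair `bb` is a doubled bit of `x`, push
  `b` on `S`; anything else (separator `01`, junk `10`, fewer than two symbols) ends `x`;
* `moveY`: move the rest of the input (`y`) onto `Y`; `restore`: move `S` back onto `k₀`
  (two reversals restore the order), enter `tm` at its main label;
* the statements of `tm` act on the `inl` stacks and the first state component, `halt` becoming
  `goto double`; `tm` halts in Mathlib's `haltList` form (output on `k₁`, rest empty);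
* `double`: move `k₁` (holding `f x`) onto `S`, doubling every symbol; `outY`: move `Y` onto
  `k₁`, then push the separator `1`, `0`; `outT`: move `S` onto `k₁`; halt. The output stack then
  holds `doubled (f x) ++ [0, 1] ++ y = boolPair (f x) y`.

Running time `≤ (3D + 1) · p(|z|) + 5|z| + 8` where `p` bounds the time of `tm` and
`D = machinePushBound tm` its pushes per step (`|f x| ≤ |x| + D · p |x|`,
`TM2Comp.length_le_of_outputsWithin`).

## Proof architecture

As in `TM2Iterate.lean` / `NondeterministicProofs.lean` (`PairFstTM`): stack bookkeeping
`mkStk` with `Function.update` lemmas; exact simulation of translated statements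
(`stepAux_liftStmt`, `step_cfgM`, `run_cfgM` via `TM2Comp.iterate_bind_map`); one-step lemmas per
control label by `simp`; phase lemmas by induction on the moved list with exact step counts;
gluing through `TM2Comp.initList_eq` / `haltList_eq`.

## References

* S. Arora, B. Barak, *Computational Complexity: A Modern Approach*, CUP 2009, Def. 2.1,
  Thm. 2.8 and Exercise 2.9 (closure of `NP` under `≤ₚ`), §1.3 (machine constructions).
* Mathlib, `Mathlib/Computability/TuringMachine/Computable.lean` (`FinTM2`, `initList`,
  `haltList`, `TM2OutputsInTime`).
-/

namespace Literature.Computability.Complexity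

open _root_.Computability PairFstTM

/-! ### Specification -/

/-- `mapFstFn f z = boolPair (f x) y'` where `x = (boolUnpair z).1` and `y' = readRest z` is the
input left when the pair reader stops (`y' = y` on `z = boolPair x y`). [Arora–Barak 2009,
Def. 2.1 / Thm. 2.8] [cite: AroraBarakCC2009, Thm. 2.8] -/
def mapFstFn (f : List Bool → List Bool) (z : List Bool) : List Bool :=
  boolPair (f (boolUnpair z).1) (readRest z)

/-- The pair reader leaves exactly `y` on `boolPair x y`. [Arora–Barak 2009, §0.1]
[cite: AroraBarakCC2009, §0.1] -/
@[simp] theorem readRest_boolPair (x y : List Bool) : readRest (boolPair x y) = y := by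
  induction x with
  | nil => simp [boolPair, readRest]
  | cons b x ih =>
    simp only [boolPair, List.flatMap_cons, List.append_assoc, List.cons_append,
      List.nil_append] at ih ⊢
    simpa [readRest] using ih

/-- **`mapFstFn f ⟨x, y⟩ = ⟨f x, y⟩`.** [Arora–Barak 2009, Thm. 2.8] [cite: AroraBarakCC2009, Thm. 2.8] -/
@[simp] theorem mapFstFn_boolPair (f : List Bool → List Bool) (x y : List Bool) :
    mapFstFn f (boolPair x y) = boolPair (f x) y := by
  simp [mapFstFn]

namespace MapFstTM

open Turing StateTransition Function TM2Comp

/-! ### Auxiliary stacks, control labels, alphabets, states -/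

/-- The two auxiliary `Bool` stacks: `S` (first component, later the doubled output) and `Y`
(the parked second component). [folklore] -/
inductive Aux
  | S
  | Y
  deriving DecidableEq, Fintype

/-- The control labels of the wrapped machine. [folklore] -/
inductive Label
  | read
  | moveY
  | restore
  | double
  | outY
  | outT
  deriving DecidableEq, Fintype

section Machine

variable {K : Type} {G : K → Type} {Λ σ : Type}

/-- Stack alphabets: those of the wrapped machine on `inl`, `Bool` on the auxiliary stacks.
[folklore] -/
abbrev Alph (G : K → Type) : K ⊕ Aux → Type := fun j =>
  Sum.casesOn (motive := fun _ => Type) j G (fun _ => Bool)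

/-- States: a state of the wrapped machine and two `Bool` registers. [folklore] -/
abbrev St (σ : Type) : Type := σ × Option Bool × Option Bool

/-- Reset both registers. [folklore] -/
def clr : St σ → St σ := fun v => (v.1, none, none)

/-- Stack contents from the stacks `T` of the wrapped machine and the contents `s`, `y` of
`S`, `Y`. [folklore] -/
def mkStk (T : ∀ k, List (G k)) (s y : List Bool) : ∀ j : K ⊕ Aux, List (Alph G j)
  | Sum.inl k => T k
  | Sum.inr Aux.S => s
  | Sum.inr Aux.Y => y

section StkLemmas

variable (T : ∀ k, List (G k)) (s y : List Bool)

/-- Reading a stack of the wrapped machine. [folklore] -/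
@[simp] theorem mkStk_inl (k : K) : mkStk T s y (Sum.inl k) = T k := rfl
/-- Reading `S`. [folklore] -/
@[simp] theorem mkStk_S : mkStk T s y (Sum.inr Aux.S) = s := rfl
/-- Reading `Y`. [folklore] -/
@[simp] theorem mkStk_Y : mkStk T s y (Sum.inr Aux.Y) = y := rfl

variable {dKA : DecidableEq (K ⊕ Aux)}

/-- Writing a stack of the wrapped machine (any decidability instance on `K ⊕ Aux`, so that the
lemma also fires on the instance bundled in a `FinTM2`). [folklore] -/
@[simp] theorem mkStk_update_inl [DecidableEq K] (k : K) (L : List (G k)) :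
    @update _ _ dKA (mkStk T s y) (Sum.inl k) L = mkStk (update T k L) s y := by
  funext j
  rcases j with k' | a
  · rcases eq_or_ne k' k with rfl | h
    · simp
    · rw [update_of_ne (by simpa using h)]; simp [update_of_ne h]
  · rw [update_of_ne (by simp)]; cases a <;> rfl

/-- Writing `S`. [folklore] -/
@[simp] theorem mkStk_update_S (s' : List Bool) :
    @update _ _ dKA (mkStk T s y) (Sum.inr Aux.S) s' = mkStk T s' y := by
  funext j
  rcases j with k' | a
  · rw [update_of_ne (by simp)]; rfl
  · cases a
    · simp
    · rw [update_of_ne (by simp)]; rfl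

/-- Writing `Y`. [folklore] -/
@[simp] theorem mkStk_update_Y (y' : List Bool) :
    @update _ _ dKA (mkStk T s y) (Sum.inr Aux.Y) y' = mkStk T s y' := by
  funext j
  rcases j with k' | a
  · rw [update_of_ne (by simp)]; rfl
  · cases a
    · rw [update_of_ne (by simp)]; rfl
    · simp

/-- The empty stack assignment. [folklore] -/
theorem mkStk_bot :
    mkStk (fun k => ([] : List (G k))) [] [] = fun j => ([] : List (Alph G j)) := by
  funext j
  rcases j with k | a
  · rfl
  · cases a <;> rfl

/-- A single-stack assignment of the wrapped machine, embedded. [folklore] -/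
theorem mkStk_bot_inl [DecidableEq K] (k : K) (L : List (G k)) :
    mkStk (update (fun k => ([] : List (G k))) k L) [] [] =
      update (fun j => ([] : List (Alph G j))) (Sum.inl k) L := by
  rw [← mkStk_bot, mkStk_update_inl]

end StkLemmas

/-- Translation of the statements of the wrapped machine: act on the `inl` stacks and the first
state component; `halt` becomes a jump to the control label `double`. [folklore] -/
def liftStmt : TM2.Stmt G Λ σ → TM2.Stmt (Alph G) (Λ ⊕ Label) (St σ)
  | TM2.Stmt.push k f q => TM2.Stmt.push (Sum.inl k) (fun v => f v.1) (liftStmt q)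
  | TM2.Stmt.peek k f q => TM2.Stmt.peek (Sum.inl k) (fun v a => (f v.1 a, v.2)) (liftStmt q)
  | TM2.Stmt.pop k f q => TM2.Stmt.pop (Sum.inl k) (fun v a => (f v.1 a, v.2)) (liftStmt q)
  | TM2.Stmt.load f q => TM2.Stmt.load (fun v => (f v.1, v.2)) (liftStmt q)
  | TM2.Stmt.branch p q₁ q₂ => TM2.Stmt.branch (fun v => p v.1) (liftStmt q₁) (liftStmt q₂)
  | TM2.Stmt.goto l => TM2.Stmt.goto fun v => Sum.inl (l v.1)
  | TM2.Stmt.halt => TM2.Stmt.goto fun _ => Sum.inr Label.double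

/-- Embedded configuration of the wrapped machine while it runs (`S` empty, `Y` parked; the
halting label is sent to `double`), unbundled form. [folklore] -/
def embed (c : TM2.Cfg G Λ σ) (y : List Bool) : TM2.Cfg (Alph G) (Λ ⊕ Label) (St σ) :=
  ⟨some (c.l.elim (Sum.inr Label.double) Sum.inl), (c.var, none, none), mkStk c.stk [] y⟩

/-- One statement of the wrapped machine is simulated exactly by its translation. [folklore] -/
theorem stepAux_liftStmt [DecidableEq K] (q : TM2.Stmt G Λ σ) (v : σ) (T : ∀ k, List (G k))
    (y : List Bool) :
    TM2.stepAux (liftStmt q) (v, none, none) (mkStk T [] y) = embed (TM2.stepAux q v T) y := by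
  induction q generalizing v T with
  | push k f q ih =>
    simp only [liftStmt, TM2.stepAux]
    rw [← ih, mkStk_inl, mkStk_update_inl]
  | peek k f q ih => simp only [liftStmt, TM2.stepAux]; exact ih _ _
  | pop k f q ih =>
    simp only [liftStmt, TM2.stepAux]
    rw [← ih, mkStk_inl, mkStk_update_inl]
  | load f q ih => simp only [liftStmt, TM2.stepAux]; exact ih _ _
  | branch p q₁ q₂ ih₁ ih₂ =>
    simp only [liftStmt, TM2.stepAux]
    cases p v
    · exact ih₂ _ _
    · exact ih₁ _ _
  | goto l => rfl
  | halt => rfl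

variable (k₀ k₁ : K) (e₀ : G k₀ ≃ Bool) (e₁ : G k₁ ≃ Bool) (main : Λ) (init : σ)

/-- The control statements (see the module docstring); every control statement resets the
registers before jumping. [Arora–Barak 2009, §1.3] [cite: AroraBarakCC2009, §1.3] -/
def ctrlStmt : Label → TM2.Stmt (Alph G) (Λ ⊕ Label) (St σ)
  | Label.read =>
      TM2.Stmt.pop (Sum.inl k₀) (fun v a => (v.1, a.map e₀, v.2.2)) <|
        TM2.Stmt.pop (Sum.inl k₀) (fun v a => (v.1, v.2.1, a.map e₀)) <|
          TM2.Stmt.branch (fun v => pairOK v.2.1 v.2.2)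
            (TM2.Stmt.push (Sum.inr Aux.S) (fun v => v.2.1.getD false) <| TM2.Stmt.load clr <|
              TM2.Stmt.goto fun _ => Sum.inr Label.read)
            (TM2.Stmt.load clr <| TM2.Stmt.goto fun _ => Sum.inr Label.moveY)
  | Label.moveY =>
      TM2.Stmt.pop (Sum.inl k₀) (fun v a => (v.1, a.map e₀, none)) <|
        TM2.Stmt.branch (fun v => v.2.1.isSome)
          (TM2.Stmt.push (Sum.inr Aux.Y) (fun v => v.2.1.getD false) <| TM2.Stmt.load clr <|
            TM2.Stmt.goto fun _ => Sum.inr Label.moveY)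
          (TM2.Stmt.load clr <| TM2.Stmt.goto fun _ => Sum.inr Label.restore)
  | Label.restore =>
      TM2.Stmt.pop (Sum.inr Aux.S) (fun v a => (v.1, a, none)) <|
        TM2.Stmt.branch (fun v => v.2.1.isSome)
          (TM2.Stmt.push (Sum.inl k₀) (fun v => e₀.symm (v.2.1.getD false)) <|
            TM2.Stmt.load clr <| TM2.Stmt.goto fun _ => Sum.inr Label.restore)
          (TM2.Stmt.load clr <| TM2.Stmt.goto fun _ => Sum.inl main)
  | Label.double =>
      TM2.Stmt.pop (Sum.inl k₁) (fun v a => (v.1, a.map e₁, none)) <|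
        TM2.Stmt.branch (fun v => v.2.1.isSome)
          (TM2.Stmt.push (Sum.inr Aux.S) (fun v => v.2.1.getD false) <|
            TM2.Stmt.push (Sum.inr Aux.S) (fun v => v.2.1.getD false) <| TM2.Stmt.load clr <|
              TM2.Stmt.goto fun _ => Sum.inr Label.double)
          (TM2.Stmt.load clr <| TM2.Stmt.goto fun _ => Sum.inr Label.outY)
  | Label.outY =>
      TM2.Stmt.pop (Sum.inr Aux.Y) (fun v a => (v.1, a, none)) <|
        TM2.Stmt.branch (fun v => v.2.1.isSome)
          (TM2.Stmt.push (Sum.inl k₁) (fun v => e₁.symm (v.2.1.getD false)) <|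
            TM2.Stmt.load clr <| TM2.Stmt.goto fun _ => Sum.inr Label.outY)
          (TM2.Stmt.push (Sum.inl k₁) (fun _ => e₁.symm true) <|
            TM2.Stmt.push (Sum.inl k₁) (fun _ => e₁.symm false) <| TM2.Stmt.load clr <|
              TM2.Stmt.goto fun _ => Sum.inr Label.outT)
  | Label.outT =>
      TM2.Stmt.pop (Sum.inr Aux.S) (fun v a => (v.1, a, none)) <|
        TM2.Stmt.branch (fun v => v.2.1.isSome)
          (TM2.Stmt.push (Sum.inl k₁) (fun v => e₁.symm (v.2.1.getD false)) <|
            TM2.Stmt.load clr <| TM2.Stmt.goto fun _ => Sum.inr Label.outT)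
          (TM2.Stmt.load (fun _ => (init, none, none)) TM2.Stmt.halt)

end Machine


/-! ### Bundling: the wrapped machine as a `FinTM2` -/

section Bundled

variable (tm : FinTM2) (e₀ : tm.Γ tm.k₀ ≃ Bool) (e₁ : tm.Γ tm.k₁ ≃ Bool)

/-- The program of the wrapped machine: translated statements of `tm` on `inl`, control
statements on `inr`. [folklore] -/
def prog : tm.Λ ⊕ Label → TM2.Stmt (Alph tm.Γ) (tm.Λ ⊕ Label) (St tm.σ)
  | Sum.inl l => liftStmt (tm.m l)
  | Sum.inr c => ctrlStmt tm.k₀ tm.k₁ e₀ e₁ tm.main tm.initialState c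

/-- **The wrapped machine** of `tm` (input/output alphabets identified with `Bool` by `e₀`,
`e₁`): on input `boolPair x y` it outputs `boolPair (f x) y` where `f` is the function computed
by `tm`. [Arora–Barak 2009, Thm. 2.8 / Ex. 2.9, §1.3] [cite: AroraBarakCC2009, Thm. 2.8] -/
def machine : FinTM2 :=
  letI := tm.kFin; letI := tm.ΛFin; letI := tm.σFin
  { K := tm.K ⊕ Aux
    k₀ := Sum.inl tm.k₀
    k₁ := Sum.inl tm.k₁
    Γ := Alph tm.Γ
    Λ := tm.Λ ⊕ Label
    main := Sum.inr Label.read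
    σ := St tm.σ
    initialState := (tm.initialState, none, none)
    Γk₀Fin := show Fintype (tm.Γ tm.k₀) from tm.Γk₀Fin
    m := prog tm e₀ e₁ }

/-- The step function of the wrapped machine, with the canonical instances. [folklore] -/
theorem machine_step (c : (machine tm e₀ e₁).Cfg) :
    (machine tm e₀ e₁).step c = TM2.step (prog tm e₀ e₁) c := rfl

/-- Configurations with reset registers, from the label, the `tm`-state, the stacks of `tm` and
the two auxiliary stacks. [folklore] -/
def cfg (l : Option (tm.Λ ⊕ Label)) (v : tm.σ) (T : ∀ k, List (tm.Γ k)) (s y : List Bool) :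
    (machine tm e₀ e₁).Cfg :=
  ⟨l, (v, none, none), mkStk T s y⟩

/-- Configuration of the wrapped machine while `tm` runs, from a configuration of `tm` and the
parked `y`. [folklore] -/
def cfgM (c : tm.Cfg) (y : List Bool) : (machine tm e₀ e₁).Cfg :=
  embed c y

/-- The stacks of `tm` holding the (remaining) input word `w` on `k₀`. [folklore] -/
def inK₀ (w : List Bool) : ∀ k, List (tm.Γ k) :=
  update (fun _ => []) tm.k₀ (w.map e₀.symm)

/-! ### Single steps of the control labels -/

section Steps

variable (v : tm.σ) (T : ∀ k, List (tm.Γ k)) (s y : List Bool)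

/-- `read` on a doubled bit `bb`: push `b` on `S`. [folklore] -/
theorem step_read_cons_cons_self (b : Bool) (rest : List Bool) :
    (machine tm e₀ e₁).step
        (cfg tm e₀ e₁ (some (Sum.inr Label.read)) v (inK₀ tm e₀ (b :: b :: rest)) s y) =
      some (cfg tm e₀ e₁ (some (Sum.inr Label.read)) v (inK₀ tm e₀ rest) (b :: s) y) := by
  rw [machine_step]; simp [cfg, TM2.step, prog, TM2.stepAux, ctrlStmt, clr, inK₀, pairOK]
  rfl

/-- `read` on an unequal pair (separator or junk): the first component has ended. [folklore] -/
theorem step_read_cons_cons_ne {b b' : Bool} (h : b ≠ b') (rest : List Bool) :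
    (machine tm e₀ e₁).step
        (cfg tm e₀ e₁ (some (Sum.inr Label.read)) v (inK₀ tm e₀ (b :: b' :: rest)) s y) =
      some (cfg tm e₀ e₁ (some (Sum.inr Label.moveY)) v (inK₀ tm e₀ rest) s y) := by
  rw [machine_step]; simp [cfg, TM2.step, prog, TM2.stepAux, ctrlStmt, clr, inK₀, pairOK, h]
  rfl

/-- `read` on a single leftover symbol. [folklore] -/
theorem step_read_single (b : Bool) :
    (machine tm e₀ e₁).step (cfg tm e₀ e₁ (some (Sum.inr Label.read)) v (inK₀ tm e₀ [b]) s y) =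
      some (cfg tm e₀ e₁ (some (Sum.inr Label.moveY)) v (inK₀ tm e₀ []) s y) := by
  rw [machine_step]; simp [cfg, TM2.step, prog, TM2.stepAux, ctrlStmt, clr, inK₀, pairOK]
  rfl

/-- `read` on empty input. [folklore] -/
theorem step_read_nil :
    (machine tm e₀ e₁).step (cfg tm e₀ e₁ (some (Sum.inr Label.read)) v (inK₀ tm e₀ []) s y) =
      some (cfg tm e₀ e₁ (some (Sum.inr Label.moveY)) v (inK₀ tm e₀ []) s y) := by
  rw [machine_step]; simp [cfg, TM2.step, prog, TM2.stepAux, ctrlStmt, clr, inK₀, pairOK]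
  rfl

/-- `moveY` on a symbol: park it on `Y`. [folklore] -/
theorem step_moveY_cons (b : Bool) (w : List Bool) :
    (machine tm e₀ e₁).step
        (cfg tm e₀ e₁ (some (Sum.inr Label.moveY)) v (inK₀ tm e₀ (b :: w)) s y) =
      some (cfg tm e₀ e₁ (some (Sum.inr Label.moveY)) v (inK₀ tm e₀ w) s (b :: y)) := by
  rw [machine_step]; simp [cfg, TM2.step, prog, TM2.stepAux, ctrlStmt, clr, inK₀]
  rfl

/-- `moveY` on empty input: proceed to `restore`. [folklore] -/
theorem step_moveY_nil :
    (machine tm e₀ e₁).step (cfg tm e₀ e₁ (some (Sum.inr Label.moveY)) v (inK₀ tm e₀ []) s y) =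
      some (cfg tm e₀ e₁ (some (Sum.inr Label.restore)) v (inK₀ tm e₀ []) s y) := by
  rw [machine_step]; simp [cfg, TM2.step, prog, TM2.stepAux, ctrlStmt, clr, inK₀]
  rfl

/-- `restore` on nonempty `S`: move one bit back to `k₀` (through `e₀.symm`). [folklore] -/
theorem step_restore_cons (b : Bool) (u : List Bool) :
    (machine tm e₀ e₁).step
        (cfg tm e₀ e₁ (some (Sum.inr Label.restore)) v (inK₀ tm e₀ u) (b :: s) y) =
      some (cfg tm e₀ e₁ (some (Sum.inr Label.restore)) v (inK₀ tm e₀ (b :: u)) s y) := by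
  rw [machine_step]; simp [cfg, TM2.step, prog, TM2.stepAux, ctrlStmt, clr, inK₀]
  rfl

/-- `restore` on empty `S`: enter `tm` at its main label. [folklore] -/
theorem step_restore_nil (u : List Bool) :
    (machine tm e₀ e₁).step (cfg tm e₀ e₁ (some (Sum.inr Label.restore)) v (inK₀ tm e₀ u) [] y) =
      some (cfg tm e₀ e₁ (some (Sum.inl tm.main)) v (inK₀ tm e₀ u) [] y) := by
  rw [machine_step]; simp [cfg, TM2.step, prog, TM2.stepAux, ctrlStmt, clr]
  rfl

/-- `double` on nonempty `k₁`: move one symbol, doubled, onto `S` (through `e₁`). [folklore] -/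
theorem step_double_cons (g : tm.Γ tm.k₁) (L : List (tm.Γ tm.k₁)) :
    (machine tm e₀ e₁).step
        (cfg tm e₀ e₁ (some (Sum.inr Label.double)) v (update T tm.k₁ (g :: L)) s y) =
      some (cfg tm e₀ e₁ (some (Sum.inr Label.double)) v (update T tm.k₁ L)
        (e₁ g :: e₁ g :: s) y) := by
  rw [machine_step]; simp [cfg, TM2.step, prog, TM2.stepAux, ctrlStmt, clr]
  rfl

/-- `double` on empty `k₁`: proceed to `outY`. [folklore] -/
theorem step_double_nil :
    (machine tm e₀ e₁).step
        (cfg tm e₀ e₁ (some (Sum.inr Label.double)) v (update T tm.k₁ []) s y) =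
      some (cfg tm e₀ e₁ (some (Sum.inr Label.outY)) v (update T tm.k₁ []) s y) := by
  rw [machine_step]; simp [cfg, TM2.step, prog, TM2.stepAux, ctrlStmt, clr]
  rfl

/-- `outY` on nonempty `Y`: move one bit to `k₁` (through `e₁.symm`). [folklore] -/
theorem step_outY_cons (b : Bool) :
    (machine tm e₀ e₁).step (cfg tm e₀ e₁ (some (Sum.inr Label.outY)) v T s (b :: y)) =
      some (cfg tm e₀ e₁ (some (Sum.inr Label.outY)) v (update T tm.k₁ (e₁.symm b :: T tm.k₁))
        s y) := by
  rw [machine_step]; simp [cfg, TM2.step, prog, TM2.stepAux, ctrlStmt, clr]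
  rfl

/-- `outY` on empty `Y`: push the separator `1`, `0` on `k₁` and proceed to `outT`. [folklore] -/
theorem step_outY_nil :
    (machine tm e₀ e₁).step (cfg tm e₀ e₁ (some (Sum.inr Label.outY)) v T s []) =
      some (cfg tm e₀ e₁ (some (Sum.inr Label.outT)) v
        (update T tm.k₁ (e₁.symm false :: e₁.symm true :: T tm.k₁)) s []) := by
  rw [machine_step]; simp [cfg, TM2.step, prog, TM2.stepAux, ctrlStmt, clr, update_idem]
  rfl

/-- `outT` on nonempty `S`: move one bit to `k₁` (through `e₁.symm`). [folklore] -/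
theorem step_outT_cons (b : Bool) :
    (machine tm e₀ e₁).step (cfg tm e₀ e₁ (some (Sum.inr Label.outT)) v T (b :: s) y) =
      some (cfg tm e₀ e₁ (some (Sum.inr Label.outT)) v (update T tm.k₁ (e₁.symm b :: T tm.k₁))
        s y) := by
  rw [machine_step]; simp [cfg, TM2.step, prog, TM2.stepAux, ctrlStmt, clr]
  rfl

/-- `outT` on empty `S`: reset the state and halt. [folklore] -/
theorem step_outT_nil :
    (machine tm e₀ e₁).step (cfg tm e₀ e₁ (some (Sum.inr Label.outT)) v T [] y) =
      some (cfg tm e₀ e₁ none tm.initialState T [] y) := by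
  rw [machine_step]; simp [cfg, TM2.step, prog, TM2.stepAux, ctrlStmt]
  rfl

/-- A step of `tm` is a step of the wrapped machine on the embedded configuration. [folklore] -/
theorem step_cfgM (a b : tm.Cfg) (h : tm.step a = some b) (y : List Bool) :
    (machine tm e₀ e₁).step (cfgM tm e₀ e₁ a y) = some (cfgM tm e₀ e₁ b y) := by
  obtain ⟨_ | l, w, T'⟩ := a
  · simp [FinTM2.step, TM2.step] at h
  · simp only [FinTM2.step, TM2.step] at h
    obtain rfl := Option.some.inj h
    rw [machine_step]
    simp only [cfgM, embed, TM2.step, prog, Option.elim, stepAux_liftStmt]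
    rfl

end Steps

/-! ### Phases -/

section Phases

variable (v : tm.σ)

/-- The `read` phase: `(boolUnpair z).1` (reversed) onto `S`, `readRest z` left on the input.
[folklore] -/
theorem iterate_read (y : List Bool) :
    ∀ z s : List Bool,
      (flip bind (machine tm e₀ e₁).step)^[readSteps z]
          (some (cfg tm e₀ e₁ (some (Sum.inr Label.read)) v (inK₀ tm e₀ z) s y)) =
        some (cfg tm e₀ e₁ (some (Sum.inr Label.moveY)) v (inK₀ tm e₀ (readRest z))
          ((boolUnpair z).1.reverse ++ s) y)
  | [], s => by
    simp only [readSteps, iterate_one, readRest, boolUnpair_fst_nil, List.reverse_nil,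
      List.nil_append]
    exact step_read_nil tm e₀ e₁ v s y
  | [b], s => by
    simp only [readSteps, iterate_one, readRest, boolUnpair_fst_single, List.reverse_nil,
      List.nil_append]
    exact step_read_single tm e₀ e₁ v s y b
  | b :: b' :: rest, s => by
    by_cases h : b = b'
    · subst h
      simp only [readSteps, readRest, boolUnpair_fst_cons_cons, if_true]
      rw [iterate_bind_succ, step_read_cons_cons_self, iterate_read y rest (b :: s)]
      simp
    · simp only [readSteps, readRest, boolUnpair_fst_cons_cons, if_neg h, iterate_one,
        List.reverse_nil, List.nil_append]
      exact step_read_cons_cons_ne tm e₀ e₁ v s y h rest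

/-- The `moveY` phase: the rest of the input (reversed) onto `Y`. [folklore] -/
theorem iterate_moveY (s : List Bool) :
    ∀ w y : List Bool,
      (flip bind (machine tm e₀ e₁).step)^[w.length + 1]
          (some (cfg tm e₀ e₁ (some (Sum.inr Label.moveY)) v (inK₀ tm e₀ w) s y)) =
        some (cfg tm e₀ e₁ (some (Sum.inr Label.restore)) v (inK₀ tm e₀ []) s (w.reverse ++ y))
  | [], y => by
    rw [List.length_nil, Nat.zero_add, iterate_bind_succ, step_moveY_nil]; rfl
  | b :: w, y => by
    rw [List.length_cons, iterate_bind_succ, step_moveY_cons, iterate_moveY s w (b :: y)]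
    simp

/-- The `restore` phase: `S` (reversed) back onto `k₀`, then enter `tm`. [folklore] -/
theorem iterate_restore (y : List Bool) :
    ∀ s u : List Bool,
      (flip bind (machine tm e₀ e₁).step)^[s.length + 1]
          (some (cfg tm e₀ e₁ (some (Sum.inr Label.restore)) v (inK₀ tm e₀ u) s y)) =
        some (cfg tm e₀ e₁ (some (Sum.inl tm.main)) v (inK₀ tm e₀ (s.reverse ++ u)) [] y)
  | [], u => by
    rw [List.length_nil, Nat.zero_add, iterate_bind_succ, step_restore_nil]; rfl
  | b :: s, u => by
    rw [List.length_cons, iterate_bind_succ, step_restore_cons, iterate_restore y s (b :: u)]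
    simp

/-- The `double` phase: `k₁` (read through `e₁`, doubled, reversed) onto `S`. [folklore] -/
theorem iterate_double (y : List Bool) (T : ∀ k, List (tm.Γ k)) :
    ∀ (L : List (tm.Γ tm.k₁)) (s : List Bool),
      (flip bind (machine tm e₀ e₁).step)^[L.length + 1]
          (some (cfg tm e₀ e₁ (some (Sum.inr Label.double)) v (update T tm.k₁ L) s y)) =
        some (cfg tm e₀ e₁ (some (Sum.inr Label.outY)) v (update T tm.k₁ [])
          (((L.map e₁).flatMap fun b => [b, b]).reverse ++ s) y)
  | [], s => by
    rw [List.length_nil, Nat.zero_add, iterate_bind_succ, step_double_nil]; simp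
  | g :: L, s => by
    rw [List.length_cons, iterate_bind_succ, step_double_cons,
      iterate_double y T L (e₁ g :: e₁ g :: s)]
    simp

/-- The `outY` phase: `Y` (reversed, through `e₁.symm`) onto `k₁`, then the separator.
[folklore] -/
theorem iterate_outY (s : List Bool) :
    ∀ (y : List Bool) (T : ∀ k, List (tm.Γ k)),
      (flip bind (machine tm e₀ e₁).step)^[y.length + 1]
          (some (cfg tm e₀ e₁ (some (Sum.inr Label.outY)) v T s y)) =
        some (cfg tm e₀ e₁ (some (Sum.inr Label.outT)) v
          (update T tm.k₁ (e₁.symm false :: e₁.symm true :: (y.reverse.map e₁.symm ++ T tm.k₁)))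
          s [])
  | [], T => by
    rw [List.length_nil, Nat.zero_add, iterate_bind_succ, step_outY_nil]; simp
  | b :: y, T => by
    rw [List.length_cons, iterate_bind_succ, step_outY_cons,
      iterate_outY s y (update T tm.k₁ (e₁.symm b :: T tm.k₁)), update_idem, update_self]
    simp

/-- The `outT` phase: `S` (reversed, through `e₁.symm`) onto `k₁`, then halt. [folklore] -/
theorem iterate_outT (y : List Bool) :
    ∀ (s : List Bool) (T : ∀ k, List (tm.Γ k)),
      (flip bind (machine tm e₀ e₁).step)^[s.length + 1]
          (some (cfg tm e₀ e₁ (some (Sum.inr Label.outT)) v T s y)) =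
        some (cfg tm e₀ e₁ none tm.initialState
          (update T tm.k₁ (s.reverse.map e₁.symm ++ T tm.k₁)) [] y)
  | [], T => by
    rw [List.length_nil, Nat.zero_add, iterate_bind_succ, step_outT_nil]; simp
  | b :: s, T => by
    rw [List.length_cons, iterate_bind_succ, step_outT_cons,
      iterate_outT y s (update T tm.k₁ (e₁.symm b :: T tm.k₁)), update_idem, update_self]
    simp

/-- A run of `tm` is a run of the wrapped machine on embedded configurations. [folklore] -/
theorem run_cfgM {n : ℕ} {a b : tm.Cfg} (h : (flip bind tm.step)^[n] (some a) = some b)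
    (y : List Bool) :
    (flip bind (machine tm e₀ e₁).step)^[n] (some (cfgM tm e₀ e₁ a y)) =
      some (cfgM tm e₀ e₁ b y) :=
  iterate_bind_map tm.step (machine tm e₀ e₁).step (fun c => cfgM tm e₀ e₁ c y)
    (fun c d hcd => step_cfgM tm e₀ e₁ c d hcd y) n a b h

end Phases

/-! ### Gluing: initial and halting configurations -/

/-- The initial configuration of the wrapped machine on the word `w`. [folklore] -/
theorem initList_machine (w : List Bool) :
    initList (machine tm e₀ e₁) (w.map e₀.symm) =
      cfg tm e₀ e₁ (some (Sum.inr Label.read)) tm.initialState (inK₀ tm e₀ w) [] [] := by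
  rw [initList_eq]
  change (⟨some (Sum.inr Label.read), (tm.initialState, none, none),
      update (fun j => ([] : List (Alph tm.Γ j))) (Sum.inl tm.k₀) (w.map e₀.symm)⟩ :
      TM2.Cfg (Alph tm.Γ) (tm.Λ ⊕ Label) (St tm.σ)) = _
  rw [← mkStk_bot_inl]
  rfl

/-- The halting configuration of the wrapped machine with output `L`. [folklore] -/
theorem haltList_machine (L : List (tm.Γ tm.k₁)) :
    haltList (machine tm e₀ e₁) L =
      cfg tm e₀ e₁ none tm.initialState (update (fun _ => []) tm.k₁ L) [] [] := by
  rw [haltList_eq]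
  change (⟨none, (tm.initialState, none, none),
      update (fun j => ([] : List (Alph tm.Γ j))) (Sum.inl tm.k₁) L⟩ :
      TM2.Cfg (Alph tm.Γ) (tm.Λ ⊕ Label) (St tm.σ)) = _
  rw [← mkStk_bot_inl]
  rfl

/-- The embedded initial configuration of `tm` on the word `w`, with `y` parked. [folklore] -/
theorem cfgM_initList (w y : List Bool) :
    cfgM tm e₀ e₁ (initList tm (w.map e₀.symm)) y =
      cfg tm e₀ e₁ (some (Sum.inl tm.main)) tm.initialState (inK₀ tm e₀ w) [] y := by
  rw [initList_eq]; rfl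

/-- The embedded halting configuration of `tm` with output `L`: the wrapped machine is at
`double`. [folklore] -/
theorem cfgM_haltList (L : List (tm.Γ tm.k₁)) (y : List Bool) :
    cfgM tm e₀ e₁ (haltList tm L) y =
      cfg tm e₀ e₁ (some (Sum.inr Label.double)) tm.initialState (update (fun _ => []) tm.k₁ L)
        [] y := by
  rw [haltList_eq]; rfl

/-! ### The whole run -/

/-- **Preprocessing.** From the initial configuration on `z` the wrapped machine reaches the
embedded initial configuration of `tm` on `(boolUnpair z).1`, with `readRest z` parked
(reversed) on `Y`, in `PairFstTM.preSteps z ≤ |z| + 3` steps. [folklore] -/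
theorem iterate_pre (z : List Bool) :
    (flip bind (machine tm e₀ e₁).step)^[PairFstTM.preSteps z]
        (some (initList (machine tm e₀ e₁) (z.map e₀.symm))) =
      some (cfgM tm e₀ e₁ (initList tm ((boolUnpair z).1.map e₀.symm)) (readRest z).reverse) := by
  have hl : (boolUnpair z).1.length = (boolUnpair z).1.reverse.length := by simp
  rw [initList_machine, PairFstTM.preSteps, iterate_add_apply _ ((boolUnpair z).1.length + 1),
    iterate_add_apply _ ((readRest z).length + 1) (readSteps z), iterate_read,
    List.append_nil, iterate_moveY, List.append_nil, hl, iterate_restore, List.reverse_reverse,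
    List.append_nil, cfgM_initList]

/-- Doubling a bit string doubles its length. [folklore] -/
theorem length_flatMap_pair (u : List Bool) :
    (u.flatMap fun b => [b, b]).length = 2 * u.length := by
  induction u with
  | nil => rfl
  | cons b u ih => simp only [List.flatMap_cons, List.cons_append, List.nil_append,
      List.length_cons, ih]; omega

/-- Steps of the postprocessing (`double`, `outY`, `outT`) for output `out` and parked `y`.
[folklore] -/
def postSteps (out y : List Bool) : ℕ :=
  ((out.flatMap fun b => [b, b]).reverse.length + 1) + ((y.length + 1) + (out.length + 1))

/-- `postSteps out y = 3 |out| + |y| + 3`. [folklore] -/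
theorem postSteps_eq (out y : List Bool) : postSteps out y = 3 * out.length + y.length + 3 := by
  rw [postSteps, List.length_reverse, length_flatMap_pair]; omega

/-- **Postprocessing.** From the embedded halting configuration of `tm` with output `out` and
`y` parked (reversed) on `Y`, the wrapped machine halts with output `boolPair out y` in
`postSteps out y` steps. [folklore] -/
theorem iterate_post (out y : List Bool) :
    (flip bind (machine tm e₀ e₁).step)^[postSteps out y]
        (some (cfgM tm e₀ e₁ (haltList tm (out.map e₁.symm)) y.reverse)) =
      some (haltList (machine tm e₀ e₁) ((boolPair out y).map e₁.symm)) := by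
  have hd := iterate_double tm e₀ e₁ tm.initialState y.reverse (fun _ => []) (out.map e₁.symm) []
  rw [List.length_map] at hd
  simp only [List.map_map, Equiv.self_comp_symm, List.map_id, List.append_nil] at hd
  have hy := iterate_outY tm e₀ e₁ tm.initialState ((out.flatMap fun b => [b, b]).reverse)
    y.reverse (update (fun _ => ([] : List (tm.Γ _))) tm.k₁ [])
  rw [update_idem, update_self, List.reverse_reverse, List.append_nil, List.length_reverse] at hy
  have ht := iterate_outT tm e₀ e₁ tm.initialState [] ((out.flatMap fun b => [b, b]).reverse)
    (update (fun _ => ([] : List (tm.Γ _))) tm.k₁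
      (e₁.symm false :: e₁.symm true :: y.map e₁.symm))
  rw [update_idem, update_self] at ht
  rw [cfgM_haltList, postSteps, iterate_add_apply _ ((out.flatMap fun b => [b, b]).reverse.length + 1),
    iterate_add_apply _ (y.length + 1) (out.length + 1), hd, hy, ht, haltList_machine]
  simp [boolPair]
  rfl

/-- **The whole run.** If `tm` maps `(boolUnpair z).1` to `out` in `n` steps then the wrapped
machine maps `z` to `boolPair out (readRest z)` in `postSteps + n + preSteps` steps.
[Arora–Barak 2009, Thm. 2.8 / Ex. 2.9] [cite: AroraBarakCC2009, Thm. 2.8] -/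
theorem iterate_run {z out : List Bool} {n : ℕ}
    (h : (flip bind tm.step)^[n] (some (initList tm ((boolUnpair z).1.map e₀.symm))) =
      some (haltList tm (out.map e₁.symm))) :
    (flip bind (machine tm e₀ e₁).step)^[postSteps out (readRest z) + (n + PairFstTM.preSteps z)]
        (some (initList (machine tm e₀ e₁) (z.map e₀.symm))) =
      some (haltList (machine tm e₀ e₁) ((boolPair out (readRest z)).map e₁.symm)) := by
  rw [iterate_add_apply _ (postSteps out (readRest z)), iterate_add_apply _ n, iterate_pre,
    run_cfgM tm e₀ e₁ h, ← List.reverse_reverse (readRest z), iterate_post, List.reverse_reverse]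

end Bundled

end MapFstTM

/-! ### Exported statements -/

open Turing MapFstTM TM2Comp

/-- The wrapped bundled machine of `M : TM2ComputableAux Bool Bool`: on `boolPair x y` it runs
`M` on `x` and outputs `boolPair (f x) y`. [Arora–Barak 2009, Thm. 2.8 / Ex. 2.9]
[cite: AroraBarakCC2009, Thm. 2.8] -/
def mapFstAux (M : TM2ComputableAux Bool Bool) : TM2ComputableAux Bool Bool where
  tm := MapFstTM.machine M.tm M.inputAlphabet M.outputAlphabet
  inputAlphabet := show M.tm.Γ M.tm.k₀ ≃ Bool from M.inputAlphabet
  outputAlphabet := show M.tm.Γ M.tm.k₁ ≃ Bool from M.outputAlphabet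

/-- **Running time of the wrapped machine**: if `M` outputs `out` on `(boolUnpair z).1` within
`m` steps then `mapFstAux M` outputs `boolPair out (readRest z)` on `z` within
`m + 3 |out| + 2 |z| + 6` steps. [Arora–Barak 2009, Thm. 2.8 / Ex. 2.9, §1.3]
[cite: AroraBarakCC2009, Thm. 2.8] -/
theorem outputsWithin_mapFstAux (M : TM2ComputableAux Bool Bool) {z out : List Bool} {m : ℕ}
    (h : M.OutputsWithin (boolUnpair z).1 out m) :
    (mapFstAux M).OutputsWithin z (boolPair out (readRest z))
      (m + 3 * out.length + 2 * z.length + 6) := by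
  obtain ⟨⟨⟨n, hn⟩, hle⟩⟩ := h
  have hpre := PairFstTM.preSteps_le z
  have hr : (readRest z).length ≤ z.length := by
    have := readSteps_add_le z
    have := one_le_readSteps z
    omega
  refine ⟨⟨⟨postSteps out (readRest z) + (n + PairFstTM.preSteps z), ?_⟩, ?_⟩⟩
  · exact iterate_run M.tm M.inputAlphabet M.outputAlphabet hn
  · change postSteps out (readRest z) + (n + PairFstTM.preSteps z) ≤ _
    change n ≤ m at hle
    rw [postSteps_eq]
    omega

open Polynomial in
/-- **`⟨x, y⟩ ↦ ⟨f x, y⟩` is in `FP` for `f ∈ FP`** — the certificate-level content of the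
closure of `NP` under Karp reductions (Arora–Barak 2009, Thm. 2.8 / Exercise 2.9). Time
polynomial `(3D + 1) · p + 5X + 6` from the time polynomial `p` of `f` and the push bound `D`
of its machine (`|f x| ≤ |x| + D · p |x|`, `TM2Comp.length_le_of_outputsWithin`).
[cite: AroraBarakCC2009, Thm. 2.8] -/
theorem mapFstFn_mem_FP {f : List Bool → List Bool} (hf : f ∈ FP) : mapFstFn f ∈ FP := by
  obtain ⟨p, M, hM⟩ := hf
  -- evaluation of an `ℕ`-polynomial is monotone (cf. `TM2Iter.eval_mono`, not imported here)
  have eval_mono : ∀ (q : Polynomial ℕ) {a b : ℕ}, a ≤ b → q.eval a ≤ q.eval b := by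
    intro q a b hab
    induction q using Polynomial.induction_on' with
    | add p q hp hq => simp only [eval_add]; exact Nat.add_le_add hp hq
    | monomial n c =>
      simp only [eval_monomial]
      exact Nat.mul_le_mul_left c (Nat.pow_le_pow_left hab n)
  refine ⟨C (3 * machinePushBound M.tm + 1) * p + 5 * X + 6, mapFstAux M, fun z => ?_⟩
  have hz := hM (boolUnpair z).1
  have hlen := length_le_of_outputsWithin M hz
  have hx := length_boolUnpair_fst_le z
  have hp := eval_mono p hx
  change (mapFstAux M).OutputsWithin z (mapFstFn f z) _
  refine (outputsWithin_mapFstAux M hz).mono ?_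
  simp only [id, eval_add, eval_mul, eval_C, eval_X, eval_ofNat] at hlen hz ⊢
  have hD : machinePushBound M.tm * p.eval (boolUnpair z).1.length ≤
      machinePushBound M.tm * p.eval z.length := Nat.mul_le_mul_left _ hp
  nlinarith [hlen, hx, hp, hD]

end Literature.Computability.Complexity
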